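import Summits.AnomalousDissipation.AnomalousDissipation.Theorems.SolenoidalFractalHomogenisationRealisedQuasiStaticCellLawGammaPos
import Summits.AnomalousDissipation.AnomalousDissipation.Theorems.SolenoidalFractalHomogenisationRealisedQuasiStaticCellLawLinkBound
import Summits.AnomalousDissipation.AnomalousDissipation.Theorems.SolenoidalFractalHomogenisationRealisedQuasiStaticCellLawUnitNormal
import Summits.AnomalousDissipation.AnomalousDissipation.Theorems.SolenoidalFractalHomogenisationRealisedQuasiStaticCellLawLadderDiagonal
import Summits.AnomalousDissipation.AnomalousDissipation.Theorems.SolenoidalFractalHomogenisationRealisedQuasiStaticCellLawGoodSlot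
import HarnessLib

/-!
# K2R `RealisedQuasiStaticCellLaw`, line `floquet-bloch`: the geometric inputs of `sectorDecay_ae` for a low sector in a good
# slot, packaged (helper towards `stub_lowSectorDecay`; `--supports stmt-AnomalousDissipation-20446`)

Summits-side helper file (everything proved; no definitions, no named facts). For a lattice phase `(m, ê)` (`ê ⊥ m`), a cell size
`n`, and a sector label `ℓ ≠ 0` with positive coupling `θ = ∑ êᵢℓᵢ > 0`, `|ℓ|² < |ℓ·K|` and `4|ℓ| ≤ |K|` (`K = n m`), all the
truncation-independent hypotheses of `sectorDecay_ae` / `sectorDecay_ae_cap` hold: no zero frequency on the coset, a unit normal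
`ζ` of `span(ℓ, K)` (`exists_unit_normal_int`, `cross_ne_zero_of_dot`), the in-plane frame `p_J`, `|p_J·p_{J+1}| ≤ 1`
(`abs_inPlane_link_le_one`), `γ² > 0` (`gamma_sq_pos`) and the diagonal bounds (`ladder_diag_bounds`) — `lowSector_inputs`
(recipe v2 §(i); the slot and the sign come from `exists_goodSlot_sign`).
-/

set_option linter.dupNamespace false

noncomputable section

namespace Summit.AnomalousDissipation.AnomalousDissipation.Theorems.SolenoidalFractalHomogenisation.RealisedQuasiStaticCellLaw

open Matrix
open scoped Matrix InnerProductSpace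
open Literature.Analysis Literature.Analysis.FunctionSpaces Literature.Analysis.FunctionSpaces.Torus
open Literature.Analysis.FluidPDE Literature.Analysis.FluidPDE.LatticeShear

/-- **Geometric inputs of the low-sector decay, packaged.** -/
theorem lowSector_inputs (P : LatticePhase) {n : ℕ} (hn : 0 < n) {ℓ : Fin 3 → ℤ} (hℓ : ℓ ≠ 0)
    (hθ : 0 < ∑ i, P.e i * (ℓ i : ℝ))
    (hfar : (fun i => ((ℓ i : ℤ) : ℝ)) ⬝ᵥ (fun i => ((ℓ i : ℤ) : ℝ)) <
      |(fun i => ((ℓ i : ℤ) : ℝ)) ⬝ᵥ (fun i => ((((fun i => P.m i * (n : ℤ)) i) : ℤ) : ℝ))|)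
    (h4 : 4 * ‖latticeVec ℓ‖ ≤ ‖latticeVec (fun i => P.m i * (n : ℤ))‖) :
    ∃ ζr : Fin 3 → ℝ, ∃ p : ℤ → Fin 3 → ℝ,
      (∀ J : ℤ, ℓ + J • (fun i => P.m i * (n : ℤ)) ≠ 0) ∧
      ζr ⬝ᵥ ζr = 1 ∧ ζr ⬝ᵥ (fun i => ((ℓ i : ℤ) : ℝ)) = 0 ∧
      ζr ⬝ᵥ (fun i => (((fun i => P.m i * (n : ℤ)) i : ℤ) : ℝ)) = 0 ∧
      (∀ J : ℤ, p J = (Real.sqrt ((fun i => (((ℓ + J • (fun i => P.m i * (n : ℤ))) i : ℤ) : ℝ)) ⬝ᵥ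
        (fun i => (((ℓ + J • (fun i => P.m i * (n : ℤ))) i : ℤ) : ℝ))))⁻¹ •
        (fun i => (((ℓ + J • (fun i => P.m i * (n : ℤ))) i : ℤ) : ℝ)) ⨯₃ ζr) ∧
      (∀ J : ℤ, |p J ⬝ᵥ p (J + 1)| ≤ 1) ∧
      0 < (p 0 ⬝ᵥ p 1) ^ 2 + (p (-1) ⬝ᵥ p 0) ^ 2 ∧
      freqNormSq ℓ / freqNormSq (fun i => P.m i * (n : ℤ)) ≤ 1 ∧
      (∀ J : ℤ, J ≠ 0 → 1 / 2 ≤ freqNormSq (ℓ + J • (fun i => P.m i * (n : ℤ))) / freqNormSq (fun i => P.m i * (n : ℤ))) ∧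
      freqNormSq (ℓ + (1 : ℤ) • (fun i => P.m i * (n : ℤ))) / freqNormSq (fun i => P.m i * (n : ℤ)) ≤ 2 ∧
      freqNormSq (ℓ + (-1 : ℤ) • (fun i => P.m i * (n : ℤ))) / freqNormSq (fun i => P.m i * (n : ℤ)) ≤ 2 := by
  set K : Fin 3 → ℤ := fun i => P.m i * (n : ℤ) with hK
  have hK0 : K ≠ 0 := cellFreq_ne_zero P hn
  -- no zero frequency on the coset
  have hk : ∀ J : ℤ, ℓ + J • K ≠ 0 := by
    intro J h0
    have hb1 : 1 ≤ ‖latticeVec K‖ := one_le_norm_latticeVec hK0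
    have hℓ1 : 1 ≤ ‖latticeVec ℓ‖ := one_le_norm_latticeVec hℓ
    have e : latticeVec ℓ = -((J : ℝ) • latticeVec K) := by
      have h1 : latticeVec (ℓ + J • K) = (0 : EuclideanSpace ℝ (Fin 3)) := by
        rw [h0]; ext i; simp
      rw [latticeVec_coset] at h1
      exact eq_neg_of_add_eq_zero_left h1
    by_cases hJ : J = 0
    · rw [hJ] at e; simp at e
      rw [e, norm_zero] at hℓ1; linarith
    · have hJ1 : (1 : ℝ) ≤ |(J : ℝ)| := by rw [← Int.cast_abs]; exact_mod_cast Int.one_le_abs hJ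
      have : ‖latticeVec ℓ‖ = |(J : ℝ)| * ‖latticeVec K‖ := by rw [e, norm_neg, norm_smul, Real.norm_eq_abs]
      nlinarith
  -- the unit normal
  have heℓ : (WithLp.ofLp P.e) ⬝ᵥ (fun i => ((ℓ i : ℤ) : ℝ)) ≠ 0 := by
    have : (WithLp.ofLp P.e) ⬝ᵥ (fun i => ((ℓ i : ℤ) : ℝ)) = ∑ i, P.e i * (ℓ i : ℝ) := rfl
    rw [this]; exact hθ.ne'
  have heK : (WithLp.ofLp P.e) ⬝ᵥ (fun i => ((K i : ℤ) : ℝ)) = 0 := by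
    have h1 : (WithLp.ofLp P.e) ⬝ᵥ (fun i => ((K i : ℤ) : ℝ)) = (n : ℝ) * ∑ i, P.e i * (P.m i : ℝ) := by
      simp only [dotProduct, hK, Int.cast_mul, Int.cast_natCast, Finset.mul_sum]
      refine Finset.sum_congr rfl fun i _ => ?_
      change P.e i * ((P.m i : ℝ) * (n : ℝ)) = (n : ℝ) * (P.e i * (P.m i : ℝ))
      ring
    rw [h1, sum_mul_intCast_eq_inner, P.e_perp, mul_zero]
  have hKr : (fun i => ((K i : ℤ) : ℝ)) ≠ 0 := by
    intro h0
    apply hK0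
    funext i
    have h1 : ((K i : ℤ) : ℝ) = 0 := congrFun h0 i
    exact_mod_cast h1
  obtain ⟨ζr, hζ1, hζ0, hζK⟩ := exists_unit_normal_int ℓ K (cross_ne_zero_of_dot _ _ _ heℓ heK hKr)
  -- the frame
  set p : ℤ → Fin 3 → ℝ := fun J => (Real.sqrt ((fun i => (((ℓ + J • K) i : ℤ) : ℝ)) ⬝ᵥ
      (fun i => (((ℓ + J • K) i : ℤ) : ℝ))))⁻¹ • (fun i => (((ℓ + J • K) i : ℤ) : ℝ)) ⨯₃ ζr with hp
  have hpJ : ∀ J : ℤ, p J = (Real.sqrt ((fun i => (((ℓ + J • K) i : ℤ) : ℝ)) ⬝ᵥ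
      (fun i => (((ℓ + J • K) i : ℤ) : ℝ))))⁻¹ • (fun i => (((ℓ + J • K) i : ℤ) : ℝ)) ⨯₃ ζr := fun J => rfl
  have hs : ∀ J : ℤ, |p J ⬝ᵥ p (J + 1)| ≤ 1 := fun J =>
    abs_inPlane_link_le_one (ℓ + J • K) (ℓ + (J + 1) • K) hζ1 (zeta_dot_coset hζ0 hζK J) (zeta_dot_coset hζ0 hζK (J + 1))
  have hγ := gamma_sq_pos ℓ K hℓ hK0 hζ1 hζ0 hζK hfar hpJ
  obtain ⟨hd0, hd, hd1, hdm1⟩ := ladder_diag_bounds hK0 h4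
  exact ⟨ζr, p, hk, hζ1, hζ0, hζK, hpJ, hs, hγ, hd0, hd, hd1, hdm1⟩

end Summit.AnomalousDissipation.AnomalousDissipation.Theorems.SolenoidalFractalHomogenisation.RealisedQuasiStaticCellLaw

end
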